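import Literature.NumberTheory.PAdicHodge.AinfWeierstrassTateModuleSupersingular
import Literature.NumberTheory.EllipticCurves.FormalGroupVerschiebungHasseZeroProofs
import Literature.NumberTheory.EllipticCurves.FormalGroupMultiplicationPrimeDecompositionInt
import Literature.NumberTheory.EllipticCurves.TateModuleFreeProofs
import Literature.NumberTheory.EllipticCurves.TateModuleFinrankProofs
import HarnessLib

/-!
# `p`-torsion of the formal group at SUPERSINGULAR reduction: `‖p‖ < ‖u‖^p`, and a Tate-module point with `u₁ ≠ 0`

Topic `Literature/NumberTheory/PAdicHodge`; namespace `Literature.NumberTheory.PAdicHodge.AinfTop`. THEOREMS ONLY (no definition,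
no named fact, no instance, no `sorry`).

For an integral Weierstrass equation `W/ℤ` and an odd prime `p` at which `W` has good SUPERSINGULAR reduction (Hasse invariant
`A_p(W mod p) = 0`), the multiplication-by-`p` series has the shape
  `[p](X) = p·R(X) + X^{p²}·S(X)`, `R, S ∈ ℤ⟦X⟧`, `R(X) = X + O(X²)`
(`exists_formalMul_prime_eq_of_hasseCoeff_eq_zero`: every coefficient of `[p]` in degree `< p²` is divisible by `p` — Silverman
AEC IV.4.4 for `p ∤ n` and the vanishing of the Verschiebung part for `A_p = 0`, tree
`coeff_formalMul_prime_eq_zero_of_hasseCoeff_eq_zero` — i.e. the formal group has height `≥ 2`). Consequences: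

* `norm_p_lt_norm_pow_of_mulPC_eq_zero` — **every nonzero `p`-torsion point `u` of `Ŵ(𝔪_{ℂ_F})` satisfies `‖p‖ < ‖u‖^p`**
  (ultrametric estimate: `p·R(u) = −u^{p²} S(u)` with `‖R(u)‖ = ‖u‖`, so `‖p‖ ≤ ‖u‖^{p²-1} < ‖u‖^p` would fail otherwise);
  this is the "point condition" `u^p ∉ (p, u^{p+1})` of the η-Hasse criterion (tree `pow_not_mem_span_of_norm_lt`) and the
  input of the non-vanishing of the ω-period. (The sharp value `v(u) = 1/(p²−1)` — Newton polygon — is not needed.)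
* `TateModule.exists_smul_eq_of_proj_one_eq_zero` — in any Tate module, a point with trivial level-`1` component is `p` times
  the shifted point; hence (`exists_seq_one_ne_zero`) **`T_pŴ(𝒪_{ℂ_F})` contains a point `τ` with `u₁ = τ₁ ≠ 0`** as soon as it
  is matched with the free rank-`2` module `T_pE` (`tateGeomEquivTatePtSS`, `module_free_tateModule_holds`,
  `finrank_tateModule_eq_two_holds`), and `exists_tatePt_norm_p_lt_norm_pow` packages the witness
  `‖u₁‖ < 1 ∧ ‖p‖ < ‖u₁‖^p` used by the de Rham assembly (BSD route EdixhovenFibreFiveSeven, crux K★, hDR|ss road).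

BSD is not proved by any of this.

## References
* [SilvermanAEC2009] J. H. Silverman, *The Arithmetic of Elliptic Curves*, IV.4.4, IV.7 (height), VII.3.
* [Tate1967] J. Tate, *p-divisible groups*, §4.
* [Serre1972] J.-P. Serre, Invent. Math. 15 (1972), §1.11 (supersingular formal groups have height 2).
-/

noncomputable section

open PowerSeries

namespace Literature.NumberTheory.PAdicHodge

open Literature Literature.NumberTheory.GaloisRepresentations Literature.NumberTheory.EllipticCurves WeierstrassCurve
open Literature.NumberTheory.GaloisRepresentations.IsNonarchimedeanLocalField Literature.NumberTheory.GaloisRepresentations.LubinTate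

namespace AinfTop

/-! ## §1 `[p] = p·R + X^{p²}·S` over `ℤ` at supersingular reduction -/

section Decomposition

variable {p : ℕ} [Fact p.Prime] (W : WeierstrassCurve ℤ)

/-- At supersingular reduction (`A_p(W mod p) = 0`, `p` odd) **every coefficient of `[p]_W` in degree `n < p²` (indeed every `n`
with `p² ∤ n`) is divisible by `p`** (height `≥ 2`). [cite: SilvermanAEC2009, IV.7.5] [cite: Serre1972, §1.11] -/
theorem prime_dvd_coeff_formalMul_of_hasseCoeff_eq_zero (hp2 : p ≠ 2) (hA : (W.map (Int.castRingHom (ZMod p))).hasseCoeff p = 0)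
    {n : ℕ} (hn : ¬ p ^ 2 ∣ n) : (p : ℤ) ∣ coeff n (W.formalMul p) := by
  have h := (W.map (Int.castRingHom (ZMod p))).coeff_formalMul_prime_eq_zero_of_hasseCoeff_eq_zero p hp2 hA hn
  rw [← WeierstrassCurve.map_formalMul, PowerSeries.coeff_map, eq_intCast] at h
  exact (ZMod.intCast_zmod_eq_zero_iff_dvd _ p).1 h

/-- **`[p](X) = p·R(X) + X^{p²}·S(X)` with `R, S ∈ ℤ⟦X⟧`, `R(0) = 0`, `R'(0) = 1`, `S(0) = [X^{p²}][p]`** at supersingular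
reduction. [cite: SilvermanAEC2009, IV.4.4 and IV.7.5] -/
theorem exists_formalMul_prime_eq_of_hasseCoeff_eq_zero (hp2 : p ≠ 2)
    (hA : (W.map (Int.castRingHom (ZMod p))).hasseCoeff p = 0) :
    ∃ R S : ℤ⟦X⟧, W.formalMul p = C (p : ℤ) * R + X ^ (p ^ 2) * S ∧ constantCoeff R = 0 ∧ coeff 1 R = 1 ∧
      constantCoeff S = coeff (p ^ 2) (W.formalMul p) := by
  have hp : p.Prime := Fact.out
  have hp1 : 1 < p ^ 2 := Nat.one_lt_pow two_ne_zero hp.one_lt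
  -- `[X][p] = p` (tree `coeff_one_formalMul`, read through `ℤ ⊆ ℚ_2`)
  have hc1 : coeff 1 (W.formalMul p) = p := by
    haveI : Fact (Nat.Prime 2) := ⟨Nat.prime_two⟩
    have h := W.coeff_formalMul_map_int (p := 2) p 1
    rw [WeierstrassCurve.coeff_one_formalMul] at h
    exact_mod_cast h.symm
  refine ⟨PowerSeries.mk fun n => if n < p ^ 2 then coeff n (W.formalMul p) / p else 0,
    PowerSeries.mk fun j => coeff (j + p ^ 2) (W.formalMul p), ?_, ?_, ?_, ?_⟩
  · ext n
    rw [map_add, coeff_C_mul, coeff_mk, coeff_X_pow_mul', coeff_mk]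
    by_cases hn : n < p ^ 2
    · have hdvd : (p : ℤ) ∣ coeff n (W.formalMul p) := by
        rcases Nat.eq_zero_or_pos n with rfl | hn0
        · rw [PowerSeries.coeff_zero_eq_constantCoeff, W.constantCoeff_formalMul]; exact dvd_zero _
        · exact prime_dvd_coeff_formalMul_of_hasseCoeff_eq_zero W hp2 hA
            fun h => absurd (Nat.le_of_dvd hn0 h) (not_le.2 hn)
      rw [if_pos hn, if_neg (not_le.2 hn), add_zero, Int.mul_ediv_cancel' hdvd]
    · rw [if_neg hn, mul_zero, zero_add, if_pos (not_lt.1 hn), Nat.sub_add_cancel (not_lt.1 hn)]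
  · rw [← coeff_zero_eq_constantCoeff_apply, coeff_mk, if_pos (lt_trans zero_lt_one hp1),
      coeff_zero_eq_constantCoeff_apply, W.constantCoeff_formalMul, Int.zero_ediv]
  · rw [coeff_mk, if_pos hp1, hc1, Int.ediv_self (Int.natCast_ne_zero.2 hp.ne_zero)]
  · rw [← coeff_zero_eq_constantCoeff_apply, coeff_mk, zero_add]

end Decomposition

/-! ## §2 Nonzero `p`-torsion points of `Ŵ(𝔪_{ℂ_F})` have `‖p‖ < ‖u‖^p` -/

section Valuation

variable {F : Type} [Field F] [ValuativeRel F] [TopologicalSpace F] [IsNonarchimedeanLocalField F] [CharZero F]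
  {p : ℕ} [Fact p.Prime] (W : WeierstrassCurve ℤ)

omit [CharZero F] in
/-- `evalAt u X = u` on `𝔪_{ℂ_F}` (the dictionary lemma `evalAt_X'` read through `maxNilIdealC F = ballNilIdeal ℂ_F`).
[cite: CasselsFrohlichANT1967, Ch. VI §3.2] -/
theorem evalAt_maxNilIdealC_X (u : (maxNilIdealC F).toIdeal) : evalAt (maxNilIdealC F) u (X : ℤ⟦X⟧) = (u : CBall F) :=
  NumberTheory.EllipticCurves.evalAt_X' (K := CompletedAlgClosure F) u

omit [CharZero F] in
/-- `evalAt u (C a) = a` on `𝔪_{ℂ_F}`. [cite: CasselsFrohlichANT1967, Ch. VI §3.2] -/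
theorem evalAt_maxNilIdealC_C (u : (maxNilIdealC F).toIdeal) (a : ℤ) : evalAt (maxNilIdealC F) u (C a) = (a : CBall F) := by
  refine (NumberTheory.EllipticCurves.evalAt_C' (K := CompletedAlgClosure F) u a).trans ?_
  rw [algebraMap_int_eq]
  rfl

omit [CharZero F] [Fact p.Prime] in
/-- Evaluation of `[p] = p·R + X^{p²}·S` at a point `u ∈ 𝔪_{ℂ_F}`: `[p](u) = p·R(u) + u^{p²}·S(u)` in `𝒪_{ℂ_F}`.
[cite: SilvermanAEC2009, IV.4.4] -/
theorem coe_mulPC_eq_of_decomp {R S : ℤ⟦X⟧} (hRS : W.formalMul p = C (p : ℤ) * R + X ^ (p ^ 2) * S)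
    (u : (maxNilIdealC F).toIdeal) :
    ((mulPC F p W u : (maxNilIdealC F).toIdeal) : CBall F) =
      (p : CBall F) * evalAt (maxNilIdealC F) u R + (u : CBall F) ^ (p ^ 2) * evalAt (maxNilIdealC F) u S := by
  rw [mulPC, coe_evalPt₁_eq_evalAt, hRS, map_add, map_mul, map_mul, map_pow, evalAt_maxNilIdealC_C, evalAt_maxNilIdealC_X,
    Int.cast_natCast]

/-- **`‖p‖ < ‖u‖^p` for every nonzero `p`-torsion point `u ∈ Ŵ(𝔪_{ℂ_F})` at supersingular reduction** (`p` odd,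
`A_p(W mod p) = 0`). From `[p](u) = 0`: `p·R(u) = −u^{p²} S(u)` with `‖R(u)‖ = ‖u‖` (`R = X + O(X²)`), so `‖p‖ ≤ ‖u‖^{p²−1}`;
if `‖u‖^p ≤ ‖p‖` this gives `‖p‖ ≤ ‖p‖·‖u‖^{p²−1−p} < ‖p‖`. [cite: Tate1967, §4] [cite: SilvermanAEC2009, IV.7 and VII.3] -/
theorem norm_p_lt_norm_pow_of_mulPC_eq_zero (hp2 : p ≠ 2) (hA : (W.map (Int.castRingHom (ZMod p))).hasseCoeff p = 0)
    (u : (maxNilIdealC F).toIdeal) (hu0 : ((u : CBall F) : CompletedAlgClosure F) ≠ 0)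
    (hu : ((mulPC F p W u : (maxNilIdealC F).toIdeal) : CBall F) = 0) :
    ‖(p : CompletedAlgClosure F)‖ < ‖((u : CBall F) : CompletedAlgClosure F)‖ ^ p := by
  have hp : p.Prime := Fact.out
  obtain ⟨R, S, hRS, hR0, hR1, -⟩ := exists_formalMul_prime_eq_of_hasseCoeff_eq_zero W hp2 hA
  -- notation in `ℂ_F`
  set x : CompletedAlgClosure F := ((u : CBall F) : CompletedAlgClosure F) with hx
  have hx1 : ‖x‖ < 1 := u.2
  have hxpos : 0 < ‖x‖ := norm_pos_iff.2 hu0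
  have hp0 : 0 < ‖(p : CompletedAlgClosure F)‖ := by
    refine norm_pos_iff.2 fun h0 => ?_
    rw [← map_natCast (algebraMap F (CompletedAlgClosure F)), _root_.map_eq_zero] at h0
    exact (Nat.cast_ne_zero.2 hp.ne_zero) h0
  -- `R = X·(1 + R₁)` with `R₁(0) = 0`, so `‖R(u)‖ = ‖u‖`
  obtain ⟨R', hR'⟩ := PowerSeries.X_dvd_iff.mpr hR0
  have hR'0 : constantCoeff R' = 1 := by
    have h := congrArg (coeff 1) hR'
    rw [hR1, PowerSeries.coeff_succ_X_mul, coeff_zero_eq_constantCoeff] at h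
    exact h.symm
  obtain ⟨R₁, hR₁⟩ := PowerSeries.X_dvd_iff.mpr (show constantCoeff (R' - 1) = 0 by rw [map_sub, hR'0, map_one, sub_self])
  have hRu : (evalAt (maxNilIdealC F) u R : CompletedAlgClosure F) =
      x * (1 + (evalAt (maxNilIdealC F) u (X * R₁) : CompletedAlgClosure F)) := by
    have hR'' : R = X * (1 + X * R₁) := by rw [← hR₁, add_sub_cancel, hR']
    rw [hR'', map_mul, map_add, map_one, evalAt_maxNilIdealC_X, Subring.coe_mul, Subring.coe_add, Subring.coe_one]
  have hsmall : ‖((evalAt (maxNilIdealC F) u (X * R₁) : CBall F) : CompletedAlgClosure F)‖ < 1 :=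
    lt_of_le_of_lt (NumberTheory.EllipticCurves.norm_evalAt_le_of_constantCoeff u
      (by rw [map_mul, constantCoeff_X, zero_mul])) hx1
  have hone : ‖(1 : CompletedAlgClosure F) + (evalAt (maxNilIdealC F) u (X * R₁) : CompletedAlgClosure F)‖ = 1 := by
    rw [IsUltrametricDist.norm_add_eq_max_of_norm_ne_norm (by rw [norm_one]; exact (ne_of_lt hsmall).symm), norm_one,
      max_eq_left hsmall.le]
  have hnormR : ‖(evalAt (maxNilIdealC F) u R : CompletedAlgClosure F)‖ = ‖x‖ := by
    rw [hRu, norm_mul, hone, mul_one]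
  -- `[p](u) = 0`: `p·R(u) = −u^{p²}·S(u)`
  have heval := coe_mulPC_eq_of_decomp W hRS u
  rw [hu] at heval
  have hS1 : ‖((evalAt (maxNilIdealC F) u S : CBall F) : CompletedAlgClosure F)‖ ≤ 1 :=
    NumberTheory.EllipticCurves.norm_coe_unitBall_le_one _
  have hkey : ‖(p : CompletedAlgClosure F)‖ * ‖x‖ ≤ ‖x‖ ^ (p ^ 2) := by
    have h1 : ((p : CBall F) : CompletedAlgClosure F) * (evalAt (maxNilIdealC F) u R : CompletedAlgClosure F) =
        -(x ^ (p ^ 2) * (evalAt (maxNilIdealC F) u S : CompletedAlgClosure F)) := by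
      have h := congrArg (fun z : CBall F => (z : CompletedAlgClosure F)) heval
      simp only [Subring.coe_add, Subring.coe_mul, SubmonoidClass.coe_pow, Subring.coe_zero] at h
      exact eq_neg_of_add_eq_zero_left h.symm
    have h2 := congrArg (fun z => ‖z‖) h1
    simp only [norm_mul, norm_neg, norm_pow, hnormR, Subring.coe_natCast] at h2
    rw [h2]
    exact mul_le_of_le_one_right (pow_nonneg (norm_nonneg _) _) hS1
  -- conclude
  by_contra hle
  rw [not_lt] at hle
  have hq : p ^ 2 = 1 + p + (p ^ 2 - 1 - p) := by
    have : p + 1 ≤ p ^ 2 := by nlinarith [hp.two_le]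
    omega
  have h3 : ‖x‖ ^ (p ^ 2) ≤ ‖x‖ * ‖(p : CompletedAlgClosure F)‖ * ‖x‖ := by
    rw [hq, pow_add, pow_add, pow_one]
    have hlast : ‖x‖ ^ (p ^ 2 - 1 - p) ≤ ‖x‖ := by
      have hne : p ^ 2 - 1 - p ≠ 0 := by
        have : p + 2 ≤ p ^ 2 := by nlinarith [hp.two_le]
        omega
      calc ‖x‖ ^ (p ^ 2 - 1 - p) ≤ ‖x‖ ^ 1 := pow_le_pow_of_le_one hxpos.le hx1.le (Nat.one_le_iff_ne_zero.2 hne)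
        _ = ‖x‖ := pow_one _
    gcongr
  have h4 : ‖(p : CompletedAlgClosure F)‖ * ‖x‖ ≤ ‖(p : CompletedAlgClosure F)‖ * ‖x‖ * ‖x‖ := by
    calc ‖(p : CompletedAlgClosure F)‖ * ‖x‖ ≤ ‖x‖ ^ (p ^ 2) := hkey
      _ ≤ ‖x‖ * ‖(p : CompletedAlgClosure F)‖ * ‖x‖ := h3
      _ = ‖(p : CompletedAlgClosure F)‖ * ‖x‖ * ‖x‖ := by ring
  have h5 : ‖(p : CompletedAlgClosure F)‖ * ‖x‖ * ‖x‖ < ‖(p : CompletedAlgClosure F)‖ * ‖x‖ * 1 := by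
    gcongr
  rw [mul_one] at h5
  exact absurd h4 (not_le.2 h5)

end Valuation

/-! ## §3 A Tate-module point with nonzero level-one component -/

section Shift

/-- **Shift in a Tate module**: if `a = (aₙ) ∈ T_pA` has `a₁ = 0`, then `a = p • b` for `b = (a_{n+1})ₙ`. [cite: Serre1968, Ch. I §1.1] -/
theorem _root_.Literature.TateModule.exists_smul_eq_of_proj_one_eq_zero {A : Type*} [AddCommGroup A] {p : ℕ} [Fact p.Prime]
    (a : TateModule A p) (h : TateModule.proj p 1 a = 0) : ∃ b : TateModule A p, (p : ℤ_[p]) • b = a := by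
  have hp : p.Prime := Fact.out
  have hcompat : ∀ n, p • TateModule.proj p (n + 1) a = TateModule.proj p n a := fun n => a.2.2 n
  have htors : ∀ n, p ^ n • TateModule.proj p (n + 1) a = 0 := by
    intro n
    induction n with
    | zero => rw [pow_zero, one_smul, zero_add]; exact h
    | succ n ih => rw [pow_succ, mul_smul, hcompat, ← ih]
  refine ⟨TateModule.mk (fun n => TateModule.proj p (n + 1) a) htors (fun n => hcompat (n + 1)), TateModule.ext fun n => ?_⟩
  rw [TateModule.proj_smul]
  change ((PadicInt.toZModPow n (p : ℤ_[p])).val) • TateModule.proj p (n + 1) a = TateModule.proj p n a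
  rw [map_natCast, ZMod.val_natCast]
  rcases Nat.lt_or_ge n 2 with hn | hn
  · interval_cases n
    · rw [pow_zero, Nat.mod_one, zero_smul]
      have h0 := a.2.1 0
      rw [pow_zero, one_smul] at h0
      exact (h0 : TateModule.proj p 0 a = 0).symm
    · rw [pow_one, Nat.mod_self, zero_smul]; exact h.symm
  · have hlt : p < p ^ n :=
      calc p = p ^ 1 := (pow_one p).symm
        _ < p ^ n := Nat.pow_lt_pow_right hp.one_lt (by omega)
    rw [Nat.mod_eq_of_lt hlt, hcompat]

end Shift

section Witness

variable {F : Type} [Field F] [ValuativeRel F] [TopologicalSpace F] [IsNonarchimedeanLocalField F] [CharZero F]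
  {p : ℕ} [Fact p.Prime] [Fact (¬ IsUnit (p : integerC F))] (W : WeierstrassCurve ℤ)

omit [CharZero F] [Fact (¬ IsUnit (p : integerC F))] in
/-- In `T_pŴ(𝒪_{ℂ_F})`: if `τ₁ = 0` then `τ ∈ p·T_pŴ`. [cite: Serre1968, Ch. I §1.1] -/
theorem exists_smul_eq_of_seq_one_eq_zero (τ : TatePt F p W) (h : ((seq W τ 1 : (maxNilIdealC F).toIdeal) : CBall F) = 0) :
    ∃ τ' : TatePt F p W, (p : ℤ_[p]) • τ' = τ :=
  TateModule.exists_smul_eq_of_proj_one_eq_zero τ (WeierstrassCurve.Pt.ext (Subtype.ext h))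

omit [Fact (¬ IsUnit (p : integerC F))] in
/-- **A point of `T_pŴ(𝒪_{ℂ_F})` with `u₁ ≠ 0`**, given a `ℤ_p`-linear identification with the geometric Tate module `T_pE` of an
elliptic curve `E/F` (free of rank `2`: a basis vector is not divisible by `p`). [cite: SilvermanAEC2009, Prop. III.7.1]
[cite: Serre1968, Ch. I §1.1] -/
theorem exists_seq_one_ne_zero (E : WeierstrassCurve F) [E.IsElliptic] (e : E.tateModule p ≃ₗ[ℤ_[p]] TatePt F p W) :
    ∃ τ : TatePt F p W, ((seq W τ 1 : (maxNilIdealC F).toIdeal) : CBall F) ≠ 0 := by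
  have hp : p.Prime := Fact.out
  have hpF : (p : F) ≠ 0 := Nat.cast_ne_zero.mpr hp.ne_zero
  haveI := E.module_free_tateModule_holds p
  haveI := E.module_finite_tateModule_holds p
  let b := Module.finBasisOfFinrankEq ℤ_[p] (E.tateModule p) (E.finrank_tateModule_eq_two_holds p hpF)
  refine ⟨e (b 0), fun h0 => ?_⟩
  obtain ⟨τ', hτ'⟩ := exists_smul_eq_of_seq_one_eq_zero W _ h0
  have h1 : b 0 = (p : ℤ_[p]) • e.symm τ' := by
    rw [← LinearEquiv.map_smul, hτ', LinearEquiv.symm_apply_apply]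
  have h2 := congrArg (fun x => b.repr x 0) h1
  simp only [Module.Basis.repr_self, Finsupp.single_eq_same, map_smul, Finsupp.smul_apply, smul_eq_mul] at h2
  have hunit : IsUnit (p : ℤ_[p]) := isUnit_iff_exists_inv.2 ⟨_, h2.symm⟩
  exact (PadicInt.norm_lt_one_iff_dvd _ |>.2 (dvd_refl _)).ne (PadicInt.isUnit_iff.1 hunit)

variable (F p) in
/-- **The witness for the `p`-adic period road at good supersingular reduction**: for `W/ℤ`, an odd prime `p` with `p ∤ Δ_W` and
`A_p(W mod p) = 0`, and a `p`-adic field `F`, there is `τ ∈ T_pŴ(𝒪_{ℂ_F})` whose first component `u₁ = τ₁` satisfies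
`‖u₁‖ < 1` and `‖p‖ < ‖u₁‖^p` (so `u₁^p ∉ (p, u₁^{p+1})` and `u₁ ∉ p𝒪_{ℂ_F}`). [cite: Tate1967, §4] [cite: SilvermanAEC2009, Prop. III.7.1 and VII.3] -/
theorem exists_tatePt_norm_p_lt_norm_pow (hp2 : p ≠ 2) (hΔ : ¬ (p : ℤ) ∣ W.Δ)
    (hA : (W.map (Int.castRingHom (ZMod p))).hasseCoeff p = 0) :
    ∃ τ : TatePt F p W, ‖(((seq W τ 1 : (maxNilIdealC F).toIdeal) : CBall F) : CompletedAlgClosure F)‖ < 1 ∧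
      ‖(p : CompletedAlgClosure F)‖ < ‖(((seq W τ 1 : (maxNilIdealC F).toIdeal) : CBall F) : CompletedAlgClosure F)‖ ^ p := by
  haveI : (curveF F W).IsElliptic :=
    ⟨by rw [WeierstrassCurve.map_Δ]; exact Ne.isUnit (Int.cast_ne_zero.mpr fun h => hΔ (h ▸ dvd_zero _))⟩
  have hpC : ‖(p : CompletedAlgClosure F)‖ < 1 := norm_natCast_C_lt_one'
  obtain ⟨τ, hτ⟩ := exists_seq_one_ne_zero W (curveF F W) (tateGeomEquivTatePtSS F W p hpC hp2 hΔ hA)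
  refine ⟨τ, (seq W τ 1).2, norm_p_lt_norm_pow_of_mulPC_eq_zero W hp2 hA (seq W τ 1)
    (fun h => hτ (by exact_mod_cast h)) ?_⟩
  rw [mulPC_seq, seq_zero]

end Witness

end AinfTop

end Literature.NumberTheory.PAdicHodge

end
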